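import Literature.NumberTheory.EllipticCurves.PAdicLFunctionMinus
import Literature.NumberTheory.EllipticCurves.Greenberg1999.TwoTorsionMuInvariant
import Summits.BirchSwinnertonDyer.Rank1Residual.X1.MuLambdaAlgebra
import Summits.BirchSwinnertonDyer.Rank1Residual.X5.TwoAdicAdditiveL2Pinch
import HarnessLib

/-!
# Cell `bsd-f1-sign2` (`p = 2`, non-CM) — candidates of the IMC lens (planner-of-record): the ± object at
# `2` is the `ℤ₂[Gal(ℂ/ℝ)]`-TYPE of the `2`-adic symbol lattice `M₂(f)`; candidate IMC-A
# `OddEvenCongruenceAtTwo` (good-ordinary `2`), crux K2 `FreeLatticeOfConnectedRealLocus`, mechanism K1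
# `CongruenceOfFreeLattice`, consequence K3 `OddBranchCertificateSupply`

HONEST FRAMING (typer seat `bsd-f1-sign2-ty`; HOME `run/shared/lean/pub/bsd-f1-sign2/`, CANDIDATES.md §2
rows IMC-A / IMC-K2 / IMC-K1): STATEMENTS ONLY — two predicates (`FreeMeasureLatticeAtTwo`,
`CongruentBranches`, definitions with bodies, parameters explicit) and four `@[conjecture] def`s (OPEN
obligations, ours; K1 is provable modulo one port, K3 is the λ-form consequence); nothing asserted, nothing
booked, no named fact, PARTITION: none moved. Source: MEMO-imc.md sha16 c24861126774286b §3 = the bodies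
of the planner's `Sketch.lean` ae5c85f25580ee0d (planner-bsd-f1-sign2-imc-g0-0, `lean check` rc 0),
re-filed VERBATIM; refuter-1 re-typed the same bodies in `Probe_imc.lean` (rc 0). REFUTER PASS:
REF1-AUDIT-v1.md §3 (sha16 fbc6cd11a14f31bf) — K2 **SURVIVES (open; contains an analytic `μ = 0`
statement at `2`)**, K1 **SURVIVES (support, provable modulo one port: convergence of the minus Riemann
sums at `2`)**, A **SURVIVES (= K1 ∘ K2; open)**, K3 **SURVIVES (= λ-equality of the `μ`-free parts)**;
BC7 CLEAN; CM self-excluded (a CM curve ordinary at `2` has `K = ℚ(√−7)` and rational `2`-torsion); no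
hidden imported fact; periods cancel in `red ∘ pfree`. REF2: pending at filing (MEMO-imc §6: the
cross-branch congruence at `2` / analytic Kida formula at `D = −4` is not in print — Matsuno 2008 Thm. 5.1
is the ALGEBRAIC formula, Adachi 2026 treats each `ωⁱ` separately under `D > 0`).

THE LENS ANSWER (MEMO-imc §0, one sentence): at `p = 2` the Teichmüller character `ω = χ₋₄ ≡ 1 (mod 2)`
and the torsion `{±1} ⊂ ℤ₂^×` acts on modular symbols as complex conjugation `c`, so the even branch
`L₂(f,α,ω⁰)` (plus symbols, `= L₂(E)`) and the odd branch `L₂(f,α,ω¹)` (minus symbols, `= L₂(E ⊗ χ₋₄)`)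
are the `(1+c)`- and `(1−c)`-shadows of ONE lattice-valued Mazur–Swinnerton-Dyer measure; the ± object
is the `ℤ₂[c]`-type of `M₂(f) = ℤ₂[c]·{G(U)}` — FREE (rhombic, `E(ℝ)` connected, `Δ < 0`) vs NON-FREE
(rectangular, `Δ > 0`) — and freeness forces the two branches to agree in `𝔽₂⟦T⟧` after stripping
`2`-powers.

BC5 WITNESS (`pub/bsd-2adic/memos/ROUTE-L2-files/oddbranch_all.tsv` sha16 5a0827a81e79746c; PARI 2.17
msfromell + α-stabilised MTT measures, Mazur–Tate elements at `n = 6, 7`, stabilised 412/413): on the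
413 semistable-at-`2` twists `E′` of additive X5 classes, `λ(L⁻_ω) = λ(L⁺)` on **289/289** rows with
`Δ_{E′} < 0` (split 145/145 · non-split 122/122 · ordinary 22/22; raw `(μ⁺, μ⁻) = (0,0)` on 289/289)
against 22/124 on the `Δ_{E′} > 0` control (raw `(1,1)` on 123/124; `λ⁻ − λ⁺` even, spread −14…32).
Habitat inside row 1 (X5-AT2-TABLE-v1.tsv 6e587e04e023064c, MEMO-imc §4b): candidate A is typed over the
332 good-ordinary classes with `sign_disc_set = {−1}` (B over 457 split + 832 non-split), 344 mixed-sign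
classes as the class-key test, 622 constant-`+1` classes as control. CHEAPEST FALSIFIER (run, local): a
row with `Δ_{E′} < 0`, `E′(ℚ)[2] = 0`, good-ordinary or multiplicative at `2`, both branches stabilised
and `λ(L⁻_ω) ≠ λ(L⁺)` kills A/B via `oddEvenLambda_of_congruence` — **0/221** (+0/68 with `2`-torsion):
NOT KILLED; stronger column (data ask D-imc-1): one coefficient of `red(pfree θ⁺ₙ) ≠ red(pfree θ⁻ₙ)`
below degree `2ⁿ` on one such row. WHY NOVEL (MEMO-imc §6): the cross-branch congruence
`L₂(f,α,ω⁰) ≡ L₂(f,α,ω¹)` in `𝔽₂⟦T⟧` on the connected-real-locus habitat (equivalently the ANALYTIC Kida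
formula for the twist by `−1` at `2`, which has no odd prime and hence no local terms) is not in print.

References: [MazurTateTeitelbaum1986Invent] §I.10, §I.13 (the measures and branches); [Matsuno2008]
Thm. 5.1 (algebraic twin); HOME MEMO-imc.md c24861126774286b §§0, 2, 3, 4, 5, 6; REF1-AUDIT-v1.md §3.
-/

set_option autoImplicit false

noncomputable section

open scoped Classical MatrixGroups ModularForm

open CongruenceSubgroup WeierstrassCurve Literature.NumberTheory.EllipticCurves
  Literature.NumberTheory.EllipticCurves.ModularForms Literature.NumberTheory.EllipticCurves.Greenberg1999
  Summit.BirchSwinnertonDyer.Rank1Residual.X1.MuLambda Summit.BirchSwinnertonDyer.Rank1Residual.X5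

namespace Summit.BirchSwinnertonDyer.Rank1Residual.F1Sign2

/-- **The ± OBJECT of the IMC lens (predicate): the pair-valued Mazur–Swinnerton-Dyer measure
`(μ⁺, μ⁻)` of `f` at `2` on the unit cosets is a CYCLIC `ℤ₂[c]`-module**, `c = diag(1,−1)`: there is a
coset `U₀ = a₀ + 2^{n₀}ℤ₂` (`a₀` odd, `n₀ ≥ 1`) with both `μ⁺(U₀) ≠ 0`, `μ⁻(U₀) ≠ 0`, such that for every
unit coset `U = a + 2ⁿℤ₂` there are `x, y ∈ ℤ₂` with `μ⁺(U) = (x + y)·μ⁺(U₀)` and `μ⁻(U) = (x − y)·μ⁻(U₀)`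
(`μ^± = msdMeasure / msdMinusMeasure f α`, the tree's MTT measures in the `re/Ω⁺`, `im/Ω⁻` coordinates).
For the Néron lattice this is «`E(ℝ)` connected» (`Δ_E < 0`, rhombic; MEMO-imc §0, K2a). A DEFINITION
(parameters `f`, `α` explicit); nothing asserted. [folklore] -/
def FreeMeasureLatticeAtTwo {N : ℕ} (f : CuspForm (Gamma0 N) 2) (α : ℚ_[2]) : Prop :=
  ∃ (n₀ : ℕ) (a₀ : ZMod (2 ^ n₀)), 1 ≤ n₀ ∧ IsUnit a₀ ∧
    msdMeasure f α n₀ a₀ ≠ 0 ∧ msdMinusMeasure f α n₀ a₀ ≠ 0 ∧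
    ∀ (n : ℕ) (a : ZMod (2 ^ n)), 1 ≤ n → IsUnit a →
      ∃ x y : ℤ_[2],
        msdMeasure f α n a = ((x : ℚ_[2]) + y) * msdMeasure f α n₀ a₀ ∧
        msdMinusMeasure f α n a = ((x : ℚ_[2]) - y) * msdMinusMeasure f α n₀ a₀

/-- **The even and `ω`-odd `2`-adic branches of `f` at `α` are CONGRUENT in `𝔽₂⟦T⟧` after stripping
`2`-powers (predicate)**: for all non-zero rationals `cp, cm` and all non-zero `Gp, Gm ∈ Λ = ℤ₂⟦T⟧` with
`ι Gp = cp · L₂(f,α,ω⁰,T)` (`padicLFunction f α`) and `ι Gm = cm · L₂(f,α,ω¹,T)`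
(`padicLFunctionMinusBranch f α 1`), `red (pfree Gp) = red (pfree Gm)` (`pfree` strips the `2`-power
content, `red` reduces to `𝔽₂⟦T⟧`; both invariant under `ℚˣ`-rescaling into `Λ`). A DEFINITION; nothing
asserted. [cite: MazurTateTeitelbaum1986Invent, §I.13 (the branches `L_p(f, α, ωⁱ, T)`)] -/
def CongruentBranches {N : ℕ} (f : CuspForm (Gamma0 N) 2) (α : ℚ_[2]) : Prop :=
  ∀ (cp cm : ℚ) (Gp Gm : IwasawaAlgebra 2), cp ≠ 0 → cm ≠ 0 → Gp ≠ 0 → Gm ≠ 0 →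
    iwasawaToPowerSeries 2 Gp = PowerSeries.C (cp : ℚ_[2]) * padicLFunction f α →
    iwasawaToPowerSeries 2 Gm = PowerSeries.C (cm : ℚ_[2]) * padicLFunctionMinusBranch f α 1 →
    red (pfree Gp) = red (pfree Gm)

/-- **CANDIDATE IMC-A `OddEvenCongruenceAtTwo` (OPEN; cell `bsd-f1-sign2`, IMC lens, good-ordinary `2`).**
For `E/ℚ` (globally minimal) good ORDINARY at `2` (`IsOrdinaryAt W 2`, `a₂ = ±1`) with `Δ_E < 0` and no
rational `2`-torsion (⟺ every curve of the isogeny class has `Δ < 0`; image `S₃`), and its newform `f`: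
the even and `ω`-odd `2`-adic `L`-functions at the unit root agree in `𝔽₂⟦T⟧` after stripping `2`-powers
(`CongruentBranches f (unitRoot W 2)`; in particular `λ(E ⊗ χ₋₄) = λ(E)` — the analytic Kida formula at `2`
for the twist by `−1`). REF1: SURVIVES (= K1 ∘ K2; `Δ < 0` and no-`2`-torsion load-bearing; passes the
root-number parity test identically). Witness: `λ⁻ = λ⁺` on 289/289 `Δ < 0` rows (ordinary 22/22), habitat
332 X5 classes. [folklore] -/
@[conjecture] def OddEvenCongruenceAtTwo : Prop :=
  ∀ (W : WeierstrassCurve ℚ) [W.IsElliptic] [W.IsGloballyMinimal],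
    IsOrdinaryAt W 2 → W.Δ < 0 → (∀ x : ℚ, ¬ HasRationalTwoTorsionX W x) →
    ∀ ⦃N : ℕ⦄ [NeZero N] (f : CuspForm (Gamma0 N) 2), IsNewformOf W f →
      CongruentBranches f (unitRoot W 2 : ℚ_[2])

/-- **CRUX IMC-K2 `FreeLatticeOfConnectedRealLocus` (OPEN; the arithmetic input — "connected real locus
⇒ free symbol lattice").** For `E/ℚ` (globally minimal) good ordinary at `2` with `Δ_E < 0` and no
rational `2`-torsion, and its newform `f`: the `2`-adic symbol lattice is `ℤ₂[c]`-free
(`FreeMeasureLatticeAtTwo f (unitRoot W 2)`). Visible pieces (MEMO-imc §2): (K2a) `L_f ⊗ ℤ₂` is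
`ℤ₂[c]`-free ⟺ `L_f` non-rectangular ⟺ `Δ < 0` (Manin constant odd); (K2b, the open core) analytic
`μ(L₂(E)) = 0` at `2` in the Néron normalisation for `S₃`-image curves (Greenberg-type `μ = 0` at `2`;
data 289/289); (K2c) `{∞,0}` lands in `Λ_E ⊗ ℤ₂` because `E(ℚ)[2] = 0`. REF1: SURVIVES (typing faithful:
`ℤ₂[c]` local ⇒ «free of rank 1» ⟺ the typed ∃; CM auto-excluded). Cheapest direct falsifier (data ask
D-imc-2): an `S₃`-image, `Δ < 0`, good-ordinary class whose `2`-power-cusp symbols are all `ν = 1`-integral.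
[folklore] -/
@[conjecture] def FreeLatticeOfConnectedRealLocus : Prop :=
  ∀ (W : WeierstrassCurve ℚ) [W.IsElliptic] [W.IsGloballyMinimal],
    IsOrdinaryAt W 2 → W.Δ < 0 → (∀ x : ℚ, ¬ HasRationalTwoTorsionX W x) →
    ∀ ⦃N : ℕ⦄ [NeZero N] (f : CuspForm (Gamma0 N) 2), IsNewformOf W f →
      FreeMeasureLatticeAtTwo f (unitRoot W 2 : ℚ_[2])

/-- **MECHANISM IMC-K1 `CongruenceOfFreeLattice` (PROVABLE modulo one port — convergence of the minus
Riemann sums at `2`; REF1: support).** For a rational newform `f` of odd level with `a₂(f) = a`, and a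
`2`-adic unit root `α` of `X² − aX + 2`: a free symbol lattice forces congruent branches. (Algebra, REF1
§3: `G(U) = (x_U + y_U c)·G(U₀)` ⇒ `μ⁺(U) = (x+y)μ⁺(U₀)`, `μ⁻(U) = (x−y)μ⁻(U₀)`, so `A^± := L^±/(2μ^±(U₀))`
lie in `Λ`, have `μ = 0` and `A⁺ ≡ A⁻ (mod 2Λ)`; `red ∘ pfree` is invariant under rescaling by `ℚˣ` into
`Λ`.) [cite: MazurTateTeitelbaum1986Invent, §I.10 (10.1)–(10.2) and §I.13 (the measures; the statement is ours)] -/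
@[conjecture] def CongruenceOfFreeLattice : Prop :=
  ∀ ⦃N : ℕ⦄ [NeZero N] (f : CuspForm (Gamma0 N) 2) (α : ℤ_[2]),
    IsNewform0 f → coeffField f = ⊥ → ¬ (2 ∣ N) → IsUnit α →
    ∀ a : ℤ, cuspCoeff f 2 = (a : ℂ) → (α : ℚ_[2]) ^ 2 - (a : ℚ_[2]) * (α : ℚ_[2]) + 2 = 0 →
    FreeMeasureLatticeAtTwo f (α : ℚ_[2]) → CongruentBranches f (α : ℚ_[2])

/-- **IMC-K3 `OddBranchCertificateSupply` (OPEN; the IMC consequence on the additive door): on the K2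
habitat every even-branch analytic certificate `AnalyticMuLambda (L₂(f,α)) ϖp 0 n` forces every odd-branch
certificate `AnalyticMuLambda (L₂(f,α,ω¹)) ϖm 0 m` to have the same `λ`: `m = n`** — the class-wide
replacement of the per-class kit certificate of the landed additive door
`AddTwoL2Pinch.bsdp_two_of_twistPinch_minimal` on the `d* = −1`, `Δ_{E′} < 0` habitat (174 of the 413 door
rows). REF1: SURVIVES (= λ-equality of the `μ`-free parts; no `ϖ = 0` junk certificate:
`AnalyticMuLambda L 0 m n → False`). In the planner's sketch this is PROVED from the λ-form
`OddEvenLambdaAtTwo` (`oddBranchCertificateSupply_of_lambda`) and that from IMC-A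
(`oddEvenLambda_of_congruence`); those λ-forms are not on HOME (REF1 ask) and are not re-filed here.
[folklore] -/
@[conjecture] def OddBranchCertificateSupply : Prop :=
  ∀ (W : WeierstrassCurve ℚ) [W.IsElliptic] [W.IsGloballyMinimal],
    IsOrdinaryAt W 2 → W.Δ < 0 → (∀ x : ℚ, ¬ HasRationalTwoTorsionX W x) →
    ∀ ⦃N : ℕ⦄ [NeZero N] (f : CuspForm (Gamma0 N) 2), IsNewformOf W f →
    ∀ (ϖp ϖm : ℚ) (n m : ℕ),
      AddTwoL2Pinch.AnalyticMuLambda (padicLFunction f (unitRoot W 2 : ℚ_[2])) ϖp 0 n →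
      AddTwoL2Pinch.AnalyticMuLambda (padicLFunctionMinusBranch f (unitRoot W 2 : ℚ_[2]) 1) ϖm 0 m →
      m = n

/-- K1 ∘ K2 ⇒ A (the thesis `OddEvenCongruenceAtTwo` is the mechanism applied to the crux), granted the
supply of the tree data the mechanism consumes: odd level (`not_dvd_level_of_isNewformOf`), rational
coefficients (`IsNewformOf.coeffField_eq_bot`), `a₂(f) = a₂(E)` and the unit-root equation — displayed
as hypotheses `hN`, `hap`, `hα`, `hroot` so that this file imports no proof file. [folklore] -/
theorem oddEvenCongruenceAtTwo_of_cruxes (hK1 : CongruenceOfFreeLattice)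
    (hK2 : FreeLatticeOfConnectedRealLocus)
    (hN : ∀ (W : WeierstrassCurve ℚ) [W.IsElliptic] [W.IsGloballyMinimal] ⦃N : ℕ⦄ [NeZero N]
      (f : CuspForm (Gamma0 N) 2), IsNewformOf W f → W.HasGoodReductionAtPrime 2 → ¬ 2 ∣ N)
    (hap : ∀ (W : WeierstrassCurve ℚ) [W.IsElliptic] [W.IsGloballyMinimal] ⦃N : ℕ⦄ [NeZero N]
      (f : CuspForm (Gamma0 N) 2), IsNewformOf W f → W.HasGoodReductionAtPrime 2 →
      cuspCoeff f 2 = ((W.frobeniusTrace 2 : ℤ) : ℂ))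
    (hα : ∀ (W : WeierstrassCurve ℚ) [W.IsElliptic] [W.IsGloballyMinimal], IsOrdinaryAt W 2 →
      IsUnit (unitRoot W 2) ∧
        (unitRoot W 2 : ℚ_[2]) ^ 2 - ((W.frobeniusTrace 2 : ℤ) : ℚ_[2]) * (unitRoot W 2 : ℚ_[2]) + 2 = 0) :
    OddEvenCongruenceAtTwo := by
  intro W _ _ hord hΔ htors N _ f hf
  have hQ : coeffField f = ⊥ := by
    rw [coeffField, IntermediateField.adjoin_eq_bot_iff]
    rintro _ ⟨n, rfl⟩
    rw [SetLike.mem_coe, IntermediateField.mem_bot]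
    exact ⟨(W.LFunction n : ℚ), by rw [map_intCast]; exact (hf.2 n).symm⟩
  obtain ⟨hunit, hroot⟩ := hα W hord
  exact hK1 f (unitRoot W 2) hf.1 hQ (hN W f hf hord.1) hunit (W.frobeniusTrace 2) (hap W f hf hord.1)
    (by exact_mod_cast hroot) (hK2 W hord hΔ htors f hf)

end Summit.BirchSwinnertonDyer.Rank1Residual.F1Sign2

end
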